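/-
Copyright (c) 2026 the pub-hodgecm-mathlib formalisation cell (harness21).  Prover seat hodgecm-mathlib-LH4-p03 (g8); dealer LH4-plan (g6) (LAYER B 3∕3, Prop. 8 first
half), 2026-09-02.  Count-neutral base layer of the dyadic (D-UNR) column (FINDING #6 of the LH4 board).
-/
import Literature.NumberTheory.Automorphic.UnitaryThreeDoubleCosetsHKStabilizerTrace
import Literature.NumberTheory.Automorphic.UnitaryThreeKHFactorization
import HarnessLib

/-!
# Flicker's Proposition 8, first half, WITHOUT `|2| = 1`: `K_H ⊆ P_H · H^K_m` and `H^K_m ≤ K_H` for the 2-free level elements `u_m^{(y,z)}`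
(Flicker, *Elementary proof of the fundamental lemma for a unitary group* (1998), Prop. 8 p. 84; Prop. 4 p. 81 — every residue characteristic)

Topic `NumberTheory/Automorphic`; namespace `Literature.NumberTheory.Automorphic.UnitaryGroup`.  THEOREMS ONLY (no `def`, no instance, no notation, no named fact,
no `sorry`).  Cell `pub/hodgecm-mathlib`, crux H413 = `stmt-HodgeConjecture-24833`; LH4 board (D-UNR) FINDING #6, LAYER B (the 2-free re-cut of Flicker's engine): the
twin of ★ `UnitaryThreeKHFactorization` over ★ `UnramifiedLocalConjDatum` and the level elements `u_m^{(y,z)}` of ★ `UnitaryThreeDoubleCosetsHKTrace` (`z + σz + yσy = 0`,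
`|y| = 1`, `|z| ≤ 1`), with `H^K_m` read through ★ `UnitaryThreeDoubleCosetsHKStabilizerTrace.flickerU_of_rel_inv_mul_mul_mem_unitaryInt_iff`.

WHERE `|2| = 1` WAS LOAD-BEARING IN ★ AND HOW IT DISAPPEARS.  ★'s pivot is «`γ + δ` is a unit» for an integral block `k = !![α,0,β;0,e,0;γ,0,δ] ∈ H ∩ K₀`
(`γ = ½((γ+δ) − (δ−γ))`).  At a dyadic place this FAILS in Flicker's frame (`E = ℚ₂(ζ₃)`, `k = ū(0, √−3)`: `γ + δ = 1 + √−3` has norm `4`): `γ + δ` is the second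
coordinate of `g·w`, `g = (α β; γ δ)` the `U(1,1)` corner, `w = (1,1)`, and `H₂(w,w) = 2`.  The 2-free pivot is **`r := δ + γ·z`**, the second coordinate of `g·w^{(z)}`,
`w^{(z)} = (z, 1)`, whose length `H₂(w^{(z)}, w^{(z)}) = z + σz = −y·σy` is a UNIT when `|y| = 1`: if `|r| < 1` then `Q(g w) = σ(αz+β)·r + σr·(αz+β)` is small, but
`Q(g w) = Q(w) = z + σz` by the block relations (`q_invariance`) — contradiction.

* `q_invariance` — `σ(αz+β)(γz+δ) + σ(γz+δ)(αz+β) = z + σz` for a block element (the corner preserves the length of `(z,1)`).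
* `v_add_mul_eq_one_of_block` — **`|δ + γz| = 1`** for an integral block when `z + σz + yσy = 0`, `|y| = 1`, `|z| ≤ 1`.
* **`exists_upper_mul_of_mem_centralizer_unitaryInt_of_rel`** — PROP. 8 first half: for `k ∈ H ∩ K₀`, `∃ p x ∈ U`, `p ∈ H ∩ K₀` upper triangular (`p₂₀ = 0`), `x ∈ H`
  with `u⁻¹ x u ∈ K₀` (`u = u_m^{(y,z)}`), `k = p·x`.  CONSTRUCTION: `r := δ + γz`, `s := r⁻¹`, `u₀ := (σr)⁻¹` (`σr = σδ + σγ·σz`), `x_p := σr·(αz+β) − z` (skew),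
  `p := !![u₀, 0, u₀·x_p; 0, e, 0; 0, 0, r]`, `x := p⁻¹k = !![σr·α − x_p·s·γ, 0, σr·β − x_p·s·δ; 0, 1, 0; s·γ, 0, s·δ]`, whose three congruence quantities of ★
  `flickerU_of_rel_inv_mul_mul_mem_unitaryInt_iff` VANISH EXACTLY (`hD′ : (σδ + σγσz)(αδ − βγ) = δ − γσz`), so `x ∈ ⋂_m H^K_m^{(y,z)}`.  Flicker's construction is the
  instance `z = 1`.
* **`mem_unitaryInt_of_flickerU_of_rel_conj_mem`** — `H^K_m ≤ K_H` (the congruences force integrality; `|z| ≤ 1` used).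
These are the hypotheses `hKPM` ∕ `hMK` of ★ (F3c-α) `DoubleCosetFixedPoints.natCard_fixedPoints_eq_finsum_relIndex_mul` (FLICKER COR. 9, COUNTED) at `M := H^K_m^{(y,z)}`.
HONEST LABEL: HC_CM is proved only modulo the printed citations (hLiu418 = `stmt-HodgeConjecture-24832`, h413 = `stmt-HodgeConjecture-24833`) until rung 0 closes; structure
theory, pays no organ, opens no road ((D-UNR) stays PRINT by D74′).

## References
* [Flicker1998UnitaryFL] Y. Z. Flicker, *Elementary proof of the fundamental lemma for a unitary group*, Canad. J. Math. 50 (1998), §2 p. 78, Prop. 4 p. 81, Prop. 8 p. 84.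
* [Rogawski1990] J. D. Rogawski, *Automorphic Representations of Unitary Groups in Three Variables* (1990), §1.9–§1.10 pp. 8–9.
-/

set_option autoImplicit false

open scoped MatrixGroups WithZero
open Matrix

namespace Literature.NumberTheory.Automorphic

namespace UnitaryGroup

open Literature.NumberTheory.Automorphic.HermitianLattice (unitaryInt mem_unitaryInt_iff UnramifiedLocalConjDatum)

section KHFactorTrace

variable {K : Type*} [Field K] [Valued K ℤᵐ⁰] {ϖ : K}
  (σ : K →+* K) {J : Matrix (Fin 3) (Fin 3) K} (hJ : J = (StdForm.antidiagonal 3).over K)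

/-- `rev` on `Fin 3`. [folklore] -/ private theorem rev0k : Fin.rev (0 : Fin 3) = 2 := rfl
/-- `rev` on `Fin 3`. [folklore] -/ private theorem rev1k : Fin.rev (1 : Fin 3) = 1 := rfl
/-- `rev` on `Fin 3`. [folklore] -/ private theorem rev2k : Fin.rev (2 : Fin 3) = 0 := rfl

omit [Valued K ℤᵐ⁰] in
include hJ in
/-- **The `U(1,1)`-corner preserves the length of `w^{(z)} = (z, 1)`**: for a block element `!![α,0,β;0,e,0;γ,0,δ] ∈ U(σ, Φ₃)`,
`σ(αz+β)·(γz+δ) + σ(γz+δ)·(αz+β) = z + σz` (the four block relations of ★ `block_relations_of_coe_eq`). [cite: Flicker1998UnitaryFL, §2 p. 78; Prop. 8 p. 84] -/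
theorem q_invariance (h : ↥(unitaryGroupOfForm σ J)) {α β γ δ e : K}
    (hh : ((h : GL (Fin 3) K) : Matrix (Fin 3) (Fin 3) K) = !![α, 0, β; 0, e, 0; γ, 0, δ]) (z : K) :
    σ (α * z + β) * (γ * z + δ) + σ (γ * z + δ) * (α * z + β) = z + σ z := by
  obtain ⟨hi, hii, hiii, hiv, -⟩ := block_relations_of_coe_eq σ hJ h hh
  rw [map_add, map_mul, map_add, map_mul]
  linear_combination (z * σ z) * hi + σ z * hii + z * hiii + hiv

include hJ in
/-- **`|δ + γ·z| = 1` for an integral block element** `k = !![α,0,β;0,e,0;γ,0,δ] ∈ H ∩ K₀` when `z + σz + yσy = 0`, `|y| = 1`, `|z| ≤ 1`: `δ + γz` is the second coordinate of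
`g·(z,1)`, and `(z,1)` has UNIT length `z + σz = −yσy` — the 2-free replacement of Flicker's «`γ + δ` is a unit» (his `(1,1)` has length `2`).
[cite: Flicker1998UnitaryFL, Prop. 8 p. 84] -/
theorem v_add_mul_eq_one_of_block (hd : UnramifiedLocalConjDatum σ ϖ) {y z : K} (hy : Valued.v y = 1) (hzv : Valued.v z ≤ 1)
    (hz : z + σ z + y * σ y = 0) {k : ↥(unitaryGroupOfForm σ J)} (hkK : k ∈ unitaryInt σ J) {α β γ δ e : K}
    (hk : ((k : GL (Fin 3) K) : Matrix (Fin 3) (Fin 3) K) = !![α, 0, β; 0, e, 0; γ, 0, δ]) :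
    Valued.v (δ + γ * z) = 1 := by
  have hint := (mem_unitaryInt_iff_forall_v_apply_le_one σ hJ hd.vσ k).1 hkK
  have hα : Valued.v α ≤ 1 := by simpa [hk] using hint 0 0
  have hβ : Valued.v β ≤ 1 := by simpa [hk] using hint 0 2
  have hγ : Valued.v γ ≤ 1 := by simpa [hk] using hint 2 0
  have hδ : Valued.v δ ≤ 1 := by simpa [hk] using hint 2 2
  have hQ := q_invariance σ hJ k hk z
  have hvN : Valued.v (z + σ z) = 1 := by
    rw [show z + σ z = -(y * σ y) by linear_combination hz, Valuation.map_neg, map_mul, hd.vσ, hy, one_mul]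
  have hr1 : Valued.v (γ * z + δ) ≤ 1 := (Valuation.map_add _ _ _).trans (max_le (by rw [map_mul]; exact mul_le_one' hγ hzv) hδ)
  have hab : Valued.v (α * z + β) ≤ 1 := (Valuation.map_add _ _ _).trans (max_le (by rw [map_mul]; exact mul_le_one' hα hzv) hβ)
  rw [show δ + γ * z = γ * z + δ by ring]
  by_contra hne
  have hlt : Valued.v (γ * z + δ) < 1 := lt_of_le_of_ne hr1 hne
  have h1 : Valued.v (σ (α * z + β) * (γ * z + δ) + σ (γ * z + δ) * (α * z + β)) < 1 := by
    refine Valuation.map_add_lt _ ?_ ?_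
    · rw [map_mul, hd.vσ]; exact (mul_le_mul' hab le_rfl).trans_lt (by rw [one_mul]; exact hlt)
    · rw [map_mul, hd.vσ]; exact (mul_le_mul' le_rfl hab).trans_lt (by rw [mul_one]; exact hlt)
  rw [hQ, hvN] at h1
  exact lt_irrefl _ h1

include hJ in
/-- **FLICKER'S PROPOSITION 8 (first half) at every residue characteristic: `K_H ⊆ P_H · H^K_m`** for the 2-free level element `u = u_m^{(y,z)}` (`z + σz + yσy = 0`,
`|y| = 1`, `|z| ≤ 1`).  For an INTEGRAL `k = !![α,0,β;0,e,0;γ,0,δ] ∈ H = Z_U(diag(1,−1,1))`: `r := δ + γz` is a unit (★ `v_add_mul_eq_one_of_block`), and with `s := r⁻¹`,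
`u₀ := (σr)⁻¹`, `x_p := σr·(αz + β) − z` (skew) the UPPER-TRIANGULAR integral element `p = !![u₀, 0, u₀·x_p; 0, e, 0; 0, 0, r] ∈ H ∩ K₀` satisfies `k = p · x` with `x ∈ H`
and `u⁻¹ x u ∈ K₀` for EVERY `m` — indeed `x = !![σr·α − x_p·s·γ, 0, σr·β − x_p·s·δ; 0,1,0; s·γ, 0, s·δ]` makes the three congruence quantities of ★
`flickerU_of_rel_inv_mul_mul_mem_unitaryInt_iff` vanish exactly.  Flicker's construction (★ `exists_upper_mul_of_mem_centralizer_unitaryInt`) is the instance `z = 1`.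
This is the hypothesis `hKPM` of ★ `natCard_fixedPoints_eq_finsum_relIndex_mul` ((F3c-α)). [cite: Flicker1998UnitaryFL, Prop. 8 p. 84] -/
theorem exists_upper_mul_of_mem_centralizer_unitaryInt_of_rel (hd : UnramifiedLocalConjDatum σ ϖ) (h2 : (2 : K) ≠ 0)
    {y z : K} (hy : Valued.v y = 1) (hzv : Valued.v z ≤ 1) (hz : z + σ z + y * σ y = 0) (m : ℕ)
    {u c k : ↥(unitaryGroupOfForm σ J)}
    (hu : ((u : GL (Fin 3) K) : Matrix (Fin 3) (Fin 3) K) = !![ϖ ^ m, y, z * (ϖ ^ m)⁻¹; 0, 1, -σ y * (ϖ ^ m)⁻¹; 0, 0, (ϖ ^ m)⁻¹])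
    (hc : ((c : GL (Fin 3) K) : Matrix (Fin 3) (Fin 3) K) = !![1, 0, 0; 0, -1, 0; 0, 0, 1])
    (hkH : k ∈ Subgroup.centralizer ({c} : Set ↥(unitaryGroupOfForm σ J))) (hkK : k ∈ unitaryInt σ J) :
    ∃ p x : ↥(unitaryGroupOfForm σ J),
      (p ∈ Subgroup.centralizer ({c} : Set ↥(unitaryGroupOfForm σ J)) ∧ p ∈ unitaryInt σ J ∧ ((p : GL (Fin 3) K) : Matrix (Fin 3) (Fin 3) K) 2 0 = 0) ∧
      (x ∈ Subgroup.centralizer ({c} : Set ↥(unitaryGroupOfForm σ J)) ∧ u⁻¹ * x * u ∈ unitaryInt σ J) ∧ k = p * x := by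
  have hσσ : ∀ x, σ (σ x) = x := hd.σσ
  -- the block shape of `k`, its relations, its integrality
  obtain ⟨α, β, γ, δ, e, hk⟩ := exists_coe_eq_block_of_mem_centralizer σ h2 hc hkH
  obtain ⟨hi, hii, hiii, hiv, hv⟩ := block_relations_of_coe_eq σ hJ k hk
  have hint := (mem_unitaryInt_iff_forall_v_apply_le_one σ hJ hd.vσ k).1 hkK
  have hα : Valued.v α ≤ 1 := by simpa [hk] using hint 0 0
  have hβ : Valued.v β ≤ 1 := by simpa [hk] using hint 0 2
  have hγ : Valued.v γ ≤ 1 := by simpa [hk] using hint 2 0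
  have hδ : Valued.v δ ≤ 1 := by simpa [hk] using hint 2 2
  have he : Valued.v e = 1 := v_eq_one_of_coe_eq_block σ hJ hd.vσ hk
  have hσzv : Valued.v (σ z) ≤ 1 := by rw [hd.vσ]; exact hzv
  -- `hD′ : σr · (αδ − βγ) = δ − γσz`
  have hD : (σ δ + σ γ * σ z) * (α * δ - β * γ) = δ - γ * σ z := by
    linear_combination δ * hiii - γ * hiv + (σ z * δ) * hi - (σ z * γ) * hii
  -- `r = δ + γz` is a unit
  have hr : Valued.v (δ + γ * z) = 1 := v_add_mul_eq_one_of_block σ hJ hd hy hzv hz hkK hk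
  have hr0 : δ + γ * z ≠ 0 := fun h => by rw [h, map_zero] at hr; exact zero_ne_one hr
  have hσr : σ (δ + γ * z) = σ δ + σ γ * σ z := by rw [map_add, map_mul]
  have hσr0 : σ δ + σ γ * σ z ≠ 0 := by rw [← hσr]; exact fun h => hr0 (by rw [← hσσ (δ + γ * z), h, map_zero])
  -- the parameters
  set s : K := (δ + γ * z)⁻¹ with hs_def
  set u₀ : K := (σ δ + σ γ * σ z)⁻¹ with hu₀_def
  set xp : K := (σ δ + σ γ * σ z) * (α * z + β) - z with hxp_def
  have hs : s * (δ + γ * z) = 1 := inv_mul_cancel₀ hr0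
  have hu₀ : u₀ * (σ δ + σ γ * σ z) = 1 := inv_mul_cancel₀ hσr0
  have hσs : σ s = u₀ := by rw [hs_def, map_inv₀, hσr]
  have hσu₀ : σ u₀ = s := by rw [hu₀_def, map_inv₀, map_add, map_mul, hσσ, hσσ, hσσ]
  have hxp : σ xp = -xp := by
    simp only [hxp_def, map_sub, map_mul, map_add, hσσ]
    linear_combination (z * σ z) * hi + σ z * hii + z * hiii + hiv
  -- valuations of the parameters
  have vs : Valued.v s = 1 := by rw [hs_def, map_inv₀, hr, inv_one]
  have vu₀ : Valued.v u₀ = 1 := by rw [← hσs, hd.vσ, vs]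
  have vσr : Valued.v (σ δ + σ γ * σ z) = 1 := by rw [← hσr, hd.vσ, hr]
  have vxp : Valued.v xp ≤ 1 := by
    refine (Valuation.map_sub _ _ _).trans (max_le ?_ hzv)
    rw [map_mul, vσr, one_mul]
    exact (Valuation.map_add _ _ _).trans (max_le (by rw [map_mul]; exact mul_le_one' hα hzv) hβ)
  -- the matrix `P` of `p` and its membership in `U`
  have hPU : Matrix.GeneralLinearGroup.mkOfDetNeZero (!![u₀, 0, u₀ * xp; 0, e, 0; 0, 0, δ + γ * z] : Matrix (Fin 3) (Fin 3) K)
      (by rw [Matrix.det_fin_three]; simp; exact ⟨⟨inv_ne_zero hσr0, fun h => by rw [h, map_zero] at he; exact zero_ne_one he⟩, hr0⟩) ∈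
      unitaryGroupOfForm σ J := by
    rw [hJ, mem_unitaryGroupOfForm_antidiagonal_iff_sum']
    intro a b
    simp only [Matrix.GeneralLinearGroup.val_mkOfDetNeZero]
    have e1 : σ u₀ * (δ + γ * z) = 1 := by rw [hσu₀, hs]
    have e2 : (σ δ + σ γ * σ z) * u₀ = 1 := by rw [mul_comm, hu₀]
    have e3 : σ u₀ * σ xp * (δ + γ * z) + (σ δ + σ γ * σ z) * (u₀ * xp) = 0 := by
      rw [hσu₀, hxp]
      linear_combination (-xp) * hs + xp * hu₀
    fin_cases a <;> fin_cases b <;>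
      simp [Fin.sum_univ_three, rev1k, rev2k, map_zero, e1, e2, hv]
    all_goals linear_combination e3
  set p : ↥(unitaryGroupOfForm σ J) := ⟨_, hPU⟩ with hp_def
  have hp : ((p : GL (Fin 3) K) : Matrix (Fin 3) (Fin 3) K) = !![u₀, 0, u₀ * xp; 0, e, 0; 0, 0, δ + γ * z] :=
    Matrix.GeneralLinearGroup.val_mkOfDetNeZero _ _
  -- the cofactor `x = p⁻¹ k` and its matrix
  set x : ↥(unitaryGroupOfForm σ J) := p⁻¹ * k with hx_def
  have hX : ((x : GL (Fin 3) K) : Matrix (Fin 3) (Fin 3) K) =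
      !![(σ δ + σ γ * σ z) * α - xp * s * γ, 0, (σ δ + σ γ * σ z) * β - xp * s * δ; 0, 1, 0; s * γ, 0, s * δ] := by
    -- `P · X = k`
    have hPX : ((p : GL (Fin 3) K) : Matrix (Fin 3) (Fin 3) K) *
        !![(σ δ + σ γ * σ z) * α - xp * s * γ, 0, (σ δ + σ γ * σ z) * β - xp * s * δ; 0, 1, 0; s * γ, 0, s * δ] =
          ((k : GL (Fin 3) K) : Matrix (Fin 3) (Fin 3) K) := by
      rw [hp, hk]
      ext i j
      fin_cases i <;> fin_cases j <;> simp [Matrix.mul_apply, Fin.sum_univ_three]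
      · linear_combination α * hu₀
      · linear_combination β * hu₀
      · linear_combination γ * hs
      · linear_combination δ * hs
    have hinv : (((p : GL (Fin 3) K)⁻¹ : GL (Fin 3) K) : Matrix (Fin 3) (Fin 3) K) * ((p : GL (Fin 3) K) : Matrix (Fin 3) (Fin 3) K) = 1 := by
      rw [← Units.val_mul, inv_mul_cancel, Units.val_one]
    rw [hx_def, Subgroup.coe_mul, Subgroup.coe_inv, Units.val_mul, ← hPX, ← Matrix.mul_assoc, hinv, Matrix.one_mul]
  -- the three congruence quantities are EXACT
  have c1 : (σ δ + σ γ * σ z) * α - xp * s * γ - 1 + s * γ * σ z = 0 := by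
    rw [hxp_def]
    linear_combination s * hD - ((σ δ + σ γ * σ z) * α - 1) * hs
  have c2 : s * γ * z + s * δ - 1 = 0 := by linear_combination hs
  have c3 : (σ δ + σ γ * σ z) * β - xp * s * δ + z * ((σ δ + σ γ * σ z) * α - xp * s * γ - 1) + σ z * (s * γ * z + s * δ - 1) = 0 := by
    rw [hxp_def]
    linear_combination (-((σ δ + σ γ * σ z) * (α * z + β)) + z + σ z) * hs
  refine ⟨p, x, ⟨mem_centralizer_of_coe_eq_block σ hc hp, ?_, by rw [hp]; rfl⟩, ⟨mem_centralizer_of_coe_eq_block σ hc hX, ?_⟩,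
    by rw [hx_def, mul_inv_cancel_left]⟩
  · -- `p ∈ K₀` by entries
    refine (mem_unitaryInt_iff_forall_v_apply_le_one σ hJ hd.vσ p).2 fun i j => ?_
    rw [hp]
    fin_cases i <;> fin_cases j <;> simp [vu₀.le, he.le, hr.le]
    · rw [vu₀, one_mul]; exact vxp
  · -- `u⁻¹ x u ∈ K₀` by ★ 2∕3: all three congruence quantities vanish, `|sγ| ≤ 1`
    refine (flickerU_of_rel_inv_mul_mul_mem_unitaryInt_iff σ hJ hd hy hz m hu hX).2 ⟨?_, ?_, ?_, ?_⟩
    · rw [map_mul, vs, one_mul]; exact hγ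
    · rw [c1, map_zero]; exact zero_le
    · rw [c2, map_zero]; exact zero_le
    · rw [c3, map_zero]; exact zero_le

include hJ in
/-- **`H^K_m ≤ K_H`** for `u = u_m^{(y,z)}` (`z + σz + yσy = 0`, `|y| = 1`, `|z| ≤ 1`): if `h ∈ H` and `u⁻¹ h u ∈ K₀` then `h ∈ K₀` — the congruences of ★
`flickerU_of_rel_inv_mul_mul_mem_unitaryInt_iff` force every entry of `h` to be integral (`|t| ≤ 1`, `|e| = 1`, `|z| ≤ 1`).  Twin of ★ `mem_unitaryInt_of_flickerU_conj_mem`; the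
hypothesis `hMK : M ≤ K` of ★ `natCard_fixedPoints_eq_finsum_relIndex_mul` ((F3c-α)). [cite: Flicker1998UnitaryFL, Prop. 4 p. 81; Prop. 8 p. 84] -/
theorem mem_unitaryInt_of_flickerU_of_rel_conj_mem (hd : UnramifiedLocalConjDatum σ ϖ) (h2 : (2 : K) ≠ 0)
    {y z : K} (hy : Valued.v y = 1) (hzv : Valued.v z ≤ 1) (hz : z + σ z + y * σ y = 0) (m : ℕ)
    {u c h : ↥(unitaryGroupOfForm σ J)}
    (hu : ((u : GL (Fin 3) K) : Matrix (Fin 3) (Fin 3) K) = !![ϖ ^ m, y, z * (ϖ ^ m)⁻¹; 0, 1, -σ y * (ϖ ^ m)⁻¹; 0, 0, (ϖ ^ m)⁻¹])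
    (hc : ((c : GL (Fin 3) K) : Matrix (Fin 3) (Fin 3) K) = !![1, 0, 0; 0, -1, 0; 0, 0, 1])
    (hhH : h ∈ Subgroup.centralizer ({c} : Set ↥(unitaryGroupOfForm σ J))) (hhu : u⁻¹ * h * u ∈ unitaryInt σ J) :
    h ∈ unitaryInt σ J := by
  obtain ⟨α, β, γ, δ, e, hh⟩ := exists_coe_eq_block_of_mem_centralizer σ h2 hc hhH
  have he : Valued.v e = 1 := v_eq_one_of_coe_eq_block σ hJ hd.vσ hh
  obtain ⟨hγ, hα', hδ', hβ'⟩ := (flickerU_of_rel_inv_mul_mul_mem_unitaryInt_iff σ hJ hd hy hz m hu hh).1 hhu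
  have ht1 : Valued.v (ϖ ^ m) ≤ 1 := hd.v_pow_le_one m
  have hσzv : Valued.v (σ z) ≤ 1 := by rw [hd.vσ]; exact hzv
  have hα : Valued.v α ≤ 1 := by
    have e1 : α = (α - e + γ * σ z) - γ * σ z + e := by ring
    rw [e1]
    refine (Valuation.map_add _ _ _).trans (max_le ((Valuation.map_sub _ _ _).trans
      (max_le (hα'.trans ht1) (by rw [map_mul]; exact mul_le_one' hγ hσzv))) he.le)
  have hδ : Valued.v δ ≤ 1 := by
    have e1 : δ = (γ * z + δ - e) - γ * z + e := by ring
    rw [e1]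
    refine (Valuation.map_add _ _ _).trans (max_le ((Valuation.map_sub _ _ _).trans
      (max_le (hδ'.trans ht1) (by rw [map_mul]; exact mul_le_one' hγ hzv))) he.le)
  have hβ : Valued.v β ≤ 1 := by
    have e1 : β = (β + z * (α - e) + σ z * (γ * z + δ - e)) - z * (α - e) - σ z * (γ * z + δ - e) := by ring
    rw [e1]
    refine (Valuation.map_sub _ _ _).trans (max_le ((Valuation.map_sub _ _ _).trans (max_le (hβ'.trans (mul_le_one' ht1 ht1)) ?_)) ?_)
    · rw [map_mul]; exact mul_le_one' hzv ((Valuation.map_sub _ _ _).trans (max_le hα he.le))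
    · rw [map_mul]; exact mul_le_one' hσzv (hδ'.trans ht1)
  refine (mem_unitaryInt_iff_forall_v_apply_le_one σ hJ hd.vσ h).2 fun i j => ?_
  rw [hh]
  fin_cases i <;> fin_cases j <;> simp [hα, hβ, hγ, hδ, he.le]

end KHFactorTrace

end UnitaryGroup

end Literature.NumberTheory.Automorphic
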